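import Literature.NumberTheory.EllipticCurves.KellerYin2024.PotentiallyGoodOrdinaryIwasawaTheoryBranch
import Literature.NumberTheory.EllipticCurves.RankinSelbergBaseChangeBadPrimesProofs
import Literature.NumberTheory.EllipticCurves.RootNumberTwistProofs
import Literature.NumberTheory.QuadraticForms.GlobalSquareTheorem
import Literature.NumberTheory.QuadraticForms.HilbertSymbolNegOneReciprocity
import Literature.NumberTheory.GaloisRepresentations.SplitsCompletelyCriteria
import Literature.NumberTheory.EllipticCurves.PAdicGrossZagierConstantTermProofs
import HarnessLib

/-!
# The genus character `χ_ε = ε ∘ N_{K/ℚ}` has conductor exponent exactly `1` above an odd prime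
# `p` unramified in `K` — PROVED (the third branch-character hypothesis of Castella–Hsieh Prop. 3.8)

Topic `Literature/NumberTheory/EllipticCurves/KellerYin2024` (sibling of
`PotentiallyGoodOrdinaryIwasawaTheoryBranch.lean`, which defines `genusHeckeCharacter K p` and proves
`χ_ε² = 1`, unramified off `p`). THEOREMS ONLY; nothing asserted. Cell `bsd-schneider-ideate`, seat
`bsd-schneider-door-c3` (prover, gen 9); consumer: the door's input `KYRead.GenusConductorOne` of crux
r3 `GordTwoBranchIMC` (route `SchneiderFreeAdditiveX3`, item stmt-BirchSwinnertonDyer-19177), i.e. the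
hypothesis "`χ` of conductor exponent `1` at every `𝔮 ∣ p`" of the PUBLISHED existence fact
`castellaHsieh2018_exists_isBranchBDPLFunction` (Castella–Hsieh, Math. Ann. 370 (2018) Prop. 3.8) for
`χ = χ_ε`.

## Statement and proof
For `K/ℚ` Galois, `p` an ODD prime UNRAMIFIED in `K`, and a place `𝔮 ∋ p` of `K`:
`(genusHeckeCharacter K p).HasConductorExponentAt 𝔮 1` (`genusHeckeCharacter_hasConductorExponentAt_one`):
* trivial on `U_𝔮^{(1)} = 1 + 𝔮𝒪_𝔮`: a principal unit `u ≡ 1 (mod 𝔮)` at a place of ODD residue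
  characteristic is a SQUARE in `K_𝔮` (`v(u − 1) < 1 = v(4)`; O'Meara 63:1b, tree
  `QuadraticForms.isSquare_of_valued_sub_one_lt`), and `χ_ε` is quadratic (`genusHeckeCharacter_sq`), so
  `χ_{ε,𝔮}(u) = χ_{ε,𝔮}(s)² = (χ_ε²)_𝔮(s) = 1` — no norm computation is needed;
* not trivial on `U_𝔮^{(0)} = 𝒪_𝔮^×` (i.e. ramified at `𝔮`): `ψ_ε = HeckeCharacter.ofDirichlet ε` is
  ramified at `p = cond ε` (`ε` primitive mod `p`, Neukirch VII (6.9)) and ramification ascends along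
  the norm at a prime unramified in `K/ℚ` (Childress Lemma 5.3 (a); tree
  `not_isUnramifiedAt_compRelNorm_ofDirichlet`).
Corollary for an imaginary quadratic `K` with `p` SPLIT (`genusHeckeCharacter_hasConductorExponentAt_one_of_split`):
the shape of the door's `KYRead.GenusConductorOne`.

References: Neukirch, *Algebraic Number Theory* VII (6.9)–(6.10) (conductor of `ψ_χ`); O'Meara,
*Introduction to Quadratic Forms* 63:1b (local squares); Childress, *Class Field Theory* Ch. 4 §5
Lemma 5.3 (a); Castella–Hsieh, Math. Ann. 370 (2018) Prop. 3.8 (the consumer's hypothesis).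
-/

noncomputable section

open scoped Classical NumberField

open NumberField IsDedekindDomain Field Rat.HeightOneSpectrum Ideal
  Literature.NumberTheory.EllipticCurves Literature.NumberTheory.EllipticCurves.ModularForms
  Literature.NumberTheory.GaloisRepresentations

namespace Literature.NumberTheory.EllipticCurves.KellerYin2024

variable (K : Type) [Field K] [NumberField K] [IsGalois ℚ K] (p : ℕ) [hp : Fact p.Prime]

omit [NumberField K] [IsGalois ℚ K] in
/-- An odd prime `p ∈ 𝔮` forces `2 ∉ 𝔮` (else `1 = a·p + b·2 ∈ 𝔮`). [folklore] -/
private theorem two_notMem_of_natCast_mem (hp2 : p ≠ 2) {w : HeightOneSpectrum (𝓞 K)}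
    (hw : ((p : ℕ) : 𝓞 K) ∈ w.asIdeal) : (2 : 𝓞 K) ∉ w.asIdeal := by
  intro h2
  have hcop : Nat.Coprime p 2 := (Nat.coprime_primes hp.out Nat.prime_two).mpr hp2
  obtain ⟨a, b, hab⟩ := (Nat.isCoprime_iff_coprime.mpr hcop)
  have hab' : (a * p + b * 2 : ℤ) = 1 := by exact_mod_cast hab
  have h1 : (1 : 𝓞 K) ∈ w.asIdeal := by
    have : ((a * p + b * 2 : ℤ) : 𝓞 K) = 1 := by rw [hab']; norm_num
    rw [← this]
    push_cast
    exact w.asIdeal.add_mem (w.asIdeal.mul_mem_left _ hw) (w.asIdeal.mul_mem_left _ h2)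
  exact w.isPrime.ne_top ((Ideal.eq_top_iff_one _).mpr h1)

/-- **`χ_ε` is trivial on the principal units `1 + 𝔮𝒪_𝔮` at every place `𝔮` of odd residue
characteristic** (`p ∈ 𝔮`, `p` odd): such a unit is a square in `K_𝔮` (O'Meara 63:1b) and `χ_ε² = 1`.
[cite: Omeara1963, §63A Cor. 63:1b (principal units are squares at non-dyadic places)] -/
theorem genusHeckeCharacter_isTrivialOnHigherUnitsAt_one (hp2 : p ≠ 2)
    {w : HeightOneSpectrum (𝓞 K)} (hw : ((p : ℕ) : 𝓞 K) ∈ w.asIdeal) :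
    (genusHeckeCharacter K p).IsTrivialOnHigherUnitsAt w 1 := by
  intro u hu
  set x : w.adicCompletion K := ((u : w.adicCompletionIntegers K) : w.adicCompletion K) with hx
  -- `v(x - 1) ≤ exp(-1) < 1 = v(4)`: `x` is a square in `K_w`
  have h4 : Valued.v (4 : w.adicCompletion K) = 1 :=
    Literature.NumberTheory.QuadraticForms.valued_four_eq_one_of_notMem w
      (two_notMem_of_natCast_mem K p hp2 hw)
  have hlt : Valued.v (x - 1) < Valued.v (4 : w.adicCompletion K) := by
    rw [h4]
    exact lt_of_le_of_lt hu (by rw [← WithZero.exp_zero]; exact WithZero.exp_lt_exp.mpr (by norm_num))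
  obtain ⟨s, hs⟩ := Literature.NumberTheory.QuadraticForms.isSquare_of_valued_sub_one_lt K w hlt
  have hx0 : x ≠ 0 := by
    rw [hx]
    exact_mod_cast u.ne_zero
  have hs0 : s ≠ 0 := fun h ↦ hx0 (by rw [hs, h, mul_zero])
  -- the unit `u` of `K_w` is `S²` with `S = s`
  have hUS : Units.map ((w.adicCompletionIntegers K).subtype : _ →* _) u = Units.mk0 s hs0 ^ 2 := by
    ext
    rw [Units.val_pow_eq_pow_val, Units.val_mk0, pow_two, ← hs]
    rfl
  rw [hUS, map_pow, HeckeCharacter.localComponent_apply, ← HeckeCharacter.pow_apply,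
    genusHeckeCharacter_sq, HeckeCharacter.one_apply]

/-- **`χ_ε` is ramified at every place above `p`, for `p` odd and unramified in `K`**: `ψ_ε` is
ramified at `p = cond ε` (`ε` primitive), and ramification ascends along `N_{K/ℚ}` at an unramified
prime. [cite: NeukirchANT1999, Ch. VII Prop. (6.9) (ψ_χ ramified exactly at the primes of the conductor)]
[cite: Childress2009, Ch. 4 §5 Lemma 5.3 (a) (PDF p. 95)] -/
theorem genusHeckeCharacter_not_isUnramifiedAt (hp2 : p ≠ 2)
    (hK : Algebra.IsUnramifiedIn (𝓞 K) (Ideal.span {(p : ℤ)}))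
    {w : HeightOneSpectrum (𝓞 K)} (hw : ((p : ℕ) : 𝓞 K) ∈ w.asIdeal) :
    ¬ (genusHeckeCharacter K p).IsUnramifiedAt w :=
  not_isUnramifiedAt_compRelNorm_ofDirichlet K (isPrimitive_quadraticChar_ringHomComp p hp2) hp.out
    (dvd_refl p) hK ⟨w.isPrime, liesOver_span_of_natCast_mem_asIdeal hp.out w hw⟩

/-- **The genus character has conductor exponent EXACTLY `1` at every place above `p`** (`p` odd,
unramified in `K`): trivial on `1 + 𝔮𝒪_𝔮`, non-trivial on `𝒪_𝔮^×`. This is the hypothesis "`χ` of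
conductor `p𝒪_K`" of Castella–Hsieh's Prop. 3.8 (tree `castellaHsieh2018_exists_isBranchBDPLFunction`)
for `χ = χ_ε`, PROVED. [cite: NeukirchANT1999, Ch. VII Prop. (6.9)–(6.10) (conductor of ψ_χ ∘ N)]
[cite: CastellaHsieh2018, Prop. 3.8 (the hypothesis on the branch character)] -/
theorem genusHeckeCharacter_hasConductorExponentAt_one (hp2 : p ≠ 2)
    (hK : Algebra.IsUnramifiedIn (𝓞 K) (Ideal.span {(p : ℤ)}))
    {w : HeightOneSpectrum (𝓞 K)} (hw : ((p : ℕ) : 𝓞 K) ∈ w.asIdeal) :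
    (genusHeckeCharacter K p).HasConductorExponentAt w 1 := by
  refine ⟨genusHeckeCharacter_isTrivialOnHigherUnitsAt_one K p hp2 hw, fun g hg ↦ ?_⟩
  obtain rfl : g = 0 := by omega
  rw [HeckeCharacter.isTrivialOnHigherUnitsAt_zero_iff]
  exact genusHeckeCharacter_not_isUnramifiedAt K p hp2 hK hw

/-- **The split case** (the door's shape `KYRead.GenusConductorOne`): for an imaginary quadratic `K`
in which the odd prime `p` splits, `χ_ε` has conductor exponent `1` at both places above `p` (a split
prime is unramified: `p ∤ d_K`, Dedekind). [cite: NeukirchANT1999, Ch. VII Prop. (6.9)–(6.10)]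
[cite: CastellaHsieh2018, Prop. 3.8 (the hypothesis on the branch character)] -/
theorem genusHeckeCharacter_hasConductorExponentAt_one_of_split (hp2 : p ≠ 2)
    (hKq : IsImaginaryQuadratic K) (hsplit : ((Ideal.span {(p : ℤ)}).primesOver (𝓞 K)).ncard = 2)
    {w : HeightOneSpectrum (𝓞 K)} (hw : ((p : ℕ) : 𝓞 K) ∈ w.asIdeal) :
    (genusHeckeCharacter K p).HasConductorExponentAt w 1 := by
  refine genusHeckeCharacter_hasConductorExponentAt_one K p hp2 ?_ hw
  have hpZ : Prime (p : ℤ) := Nat.prime_iff_prime_int.mp hp.out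
  exact (NumberField.not_dvd_discr_iff_isUnramifiedIn K (𝓞 K) hpZ).mp
    (not_dvd_discr_of_ncard_primesOver hp.out (hsplit.trans hKq.1.symm))

end Literature.NumberTheory.EllipticCurves.KellerYin2024

end
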